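import Mathlib
import HarnessLib
import Summits.AtomisticToContinuum.FouriersLaw.Theses.JunctionLocality
import Summits.AtomisticToContinuum.FouriersLaw.Theses.SpatialCentreManifold

/-!
# `ConductanceLowerBound` is the "no insulating floor" half of the affine resistance law
(stub for crux `JunctionLocality.SuperadditiveResistance`, stmt-AtomisticToContinuum-11748, line
floating-probe-bypass-laplacian, crux-position web; lead c7, 2026-08-17)

Route `SpatialCentreManifold` carries, along the weak-NESS shell of `pinnedChain ω₂ lam β γ`, the two-sided rate
statement `AffineResistanceLaw` (stmt-AtomisticToContinuum-13407):
`∃ r > 0 ∀ family ∀ D ∃ C ∀ N, |R_N − (N−1)·r| ≤ C` with `R_N := (N−1)/D_N`.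
Route `JunctionLocality` asks, over the SAME shell (same uniqueness hypothesis, same steady-state families, same
response coefficients), for `ConductanceLowerBound` (stmt-AtomisticToContinuum-11749):
`∃ c > 0 ∃ N₁ ∀ N ≥ N₁, c ≤ D_N` (the conductance is eventually bounded away from `0`).

This file records the elementary implication `AffineResistanceLaw → ConductanceLowerBound`
(real analysis: with `c := 1/(2r)` and `N₁ := ⌈(|C| + 1)/r⌉₊ + 2`, for `N ≥ N₁` one has
`(N−1)r ≥ |C| + 1 + r`, so `R_N ≥ (N−1)r − C > 0` forces `D_N > 0`, and `R_N ≤ (N−1)r + C ≤ 2(N−1)r` divided by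
`N − 1 > 0` is `1/D_N ≤ 2r`, i.e. `1/(2r) ≤ D_N`). Standard axioms; no named fact is taken.
-/

noncomputable section

open MeasureTheory Filter Topology
open Literature.MathematicalPhysics.KineticTheory.HeatConduction

namespace Summit.AtomisticToContinuum.FouriersLaw.Cruxes.SuperadditiveResistance.CruxPosition

/-- **Real-analysis core.** If the resistances `R_N = (N−1)/D_N` stay within `C` of the affine law `(N−1)·r`
with `r > 0` for all `N`, then `D_N ≥ 1/(2r)` for all `N ≥ ⌈(|C| + 1)/r⌉₊ + 2`: for such `N`,
`(N−1)r ≥ |C| + 1 + r`, hence `R_N ≥ (N−1)r − C > 0` (so `D_N > 0`, as `D_N ≤ 0` would give `R_N ≤ 0`), and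
`R_N ≤ (N−1)r + C ≤ 2(N−1)r`, which after division by `N − 1 > 0` reads `1 ≤ 2r·D_N`. -/
theorem eventuallyLowerBound_of_affine_bounds {D : ℕ → ℝ} {r C : ℝ} (hr : 0 < r)
    (h : ∀ N : ℕ, |((N : ℝ) - 1) / D N - ((N : ℝ) - 1) * r| ≤ C) :
    ∃ c : ℝ, 0 < c ∧ ∃ N₁ : ℕ, ∀ N : ℕ, N₁ ≤ N → c ≤ D N := by
  refine ⟨1 / (2 * r), by positivity, ⌈(|C| + 1) / r⌉₊ + 2, fun N hN => ?_⟩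
  have hceil : (|C| + 1) / r ≤ (⌈(|C| + 1) / r⌉₊ : ℝ) := Nat.le_ceil _
  have hcast : ((⌈(|C| + 1) / r⌉₊ : ℕ) : ℝ) + 2 ≤ (N : ℝ) := by
    exact_mod_cast hN
  have h1 : (|C| + 1) / r + 1 ≤ (N : ℝ) - 1 := by linarith
  have h2 : |C| + 1 + r ≤ ((N : ℝ) - 1) * r := by
    have h1' := mul_le_mul_of_nonneg_right h1 hr.le
    rwa [add_mul, one_mul, div_mul_cancel₀ _ hr.ne'] at h1'
  have hC0 : C ≤ |C| := le_abs_self C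
  have hN1 : 0 < (N : ℝ) - 1 := by
    have h0 : (0 : ℝ) ≤ (|C| + 1) / r := by positivity
    linarith
  obtain ⟨hl, hu⟩ := abs_le.mp (h N)
  have h3 : 0 < ((N : ℝ) - 1) / D N := by linarith
  have hD : 0 < D N := by
    rcases le_or_gt (D N) 0 with hD | hD
    · exact absurd h3 (not_lt.mpr (div_nonpos_of_nonneg_of_nonpos hN1.le hD))
    · exact hD
  have h4 : ((N : ℝ) - 1) / D N ≤ 2 * (((N : ℝ) - 1) * r) := by linarith
  rw [div_le_iff₀ hD] at h4
  rw [div_le_iff₀ (by positivity : (0 : ℝ) < 2 * r)]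
  have h5 : ((N : ℝ) - 1) * 1 ≤ ((N : ℝ) - 1) * (D N * (2 * r)) := by
    calc ((N : ℝ) - 1) * 1 = (N : ℝ) - 1 := mul_one _
      _ ≤ 2 * (((N : ℝ) - 1) * r) * D N := h4
      _ = ((N : ℝ) - 1) * (D N * (2 * r)) := by ring
  exact le_of_mul_le_mul_left h5 hN1

/-- **`AffineResistanceLaw → ConductanceLowerBound`.** Instantiate the affine law (stmt-AtomisticToContinuum-13407)
at the given parameters, uniqueness hypothesis and temperature, feed it the given steady-state family and response
coefficients, and apply `eventuallyLowerBound_of_affine_bounds`. -/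
theorem conductanceLowerBound_of_affineResistanceLaw :
    Summit.AtomisticToContinuum.FouriersLaw.Theses.SpatialCentreManifold.AffineResistanceLaw →
      Summit.AtomisticToContinuum.FouriersLaw.Theses.JunctionLocality.ConductanceLowerBound := by
  intro h ω₂ lam β γ hω hl hβ hγ hU μ hμ T hT D hD
  obtain ⟨r, hr, hfam⟩ := h ω₂ lam β γ hω hl hβ hγ hU T hT
  obtain ⟨C, hC⟩ := hfam μ hμ D hD
  exact eventuallyLowerBound_of_affine_bounds hr hC

end Summit.AtomisticToContinuum.FouriersLaw.Cruxes.SuperadditiveResistance.CruxPosition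

end
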